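/-
Copyright: fleet lead `ym-wcr-19609-p1` (seat prover-ym-wcr-19609-p1-g0-0), route `WeakCouplingRates`, crux
`BulkDominatesColdBoxW` (stmt-QuantumFields-19609), line `dlr-chessboard` (skeleton v4, sha16 355a68b80645dd42).
-/
import Summits.QuantumFields.YangMills.Theorems.WeakCouplingRatesBulkDominatesColdBoxWDefs
import Literature.MathematicalPhysics.QuantumLattice.LatticeGaugeDLRProofs
import Literature.MathematicalPhysics.QuantumLattice.LatticeGaugeDLRGibbsProofs
import Summits.QuantumFields.YangMills.Theorems.WeakCouplingRatesBulkDominatesColdBoxWDlrPlumbing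

/-!
# Kernel means of gauge-invariant observables do not see the gauge of the boundary datum (brick B3 toward the open
# stubs L1a/L1b of crux `BulkDominatesColdBoxW`, stmt-QuantumFields-19609)

WHY.  L1a (`GoodBoundaryCovStable`) and L1b (`GoodBoundaryMeanSmooth`) are statements about kernel means
`∫ F dγ_Λ(·|ω)`, `γ_Λ(·|ω) = ymSpecification ρ β Λ ω`, of the GAUGE-INVARIANT observables `c_p`, `c_{p'}`, `c_p c_{p'}`, uniformly over
crude-good `ω` — a condition on the PLAQUETTES of `ω`, i.e. on its gauge class.  Step 0 of any proof replaces `ω` by a convenient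
gauge transform `ω^g` (comb gauge with small links: bricks B1 `…AxialSmallLinks`, B2 `…BallDatumLargeField`).  This file supplies the
licence: by the gauge covariance of the Wilson specification (tree `ymSpecification_map_gaugeTransformZd_holds`: the push-forward of
`γ_Λ(·|η)` under a gauge transformation is `γ_Λ(·|η^g)`), kernel means of gauge-invariant measurable `F` are the same at `η` and `η^g`
(`integral_ymSpecification_gaugeTransformZd`), in particular for the plaquette costs and their products
(`integral_plaqCostAt_ymSpecification_gaugeTransformZd`, `integral_plaqCostAt_mul_ymSpecification_gaugeTransformZd`).  Together with
quasilocality (tree `dependsOn_integral_ymSpecification`: the mean only reads `η` on the collar of `Λ`) this is the complete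
«WLOG the datum has small links everywhere» reduction, up to the comb-gauge construction of B1.

NOT a claim about the mass gap; general compact second-countable `G`, continuous `ρ`, any finite `Λ`, any `β`.

References: E. Seiler, LNP 159 (1982) Ch. 2 (gauge covariance of the Wilson specification); H.-O. Georgii (2011) (2.15).
-/

set_option autoImplicit false

noncomputable section

open MeasureTheory
open Literature.MathematicalPhysics Literature.MathematicalPhysics.QuantumFieldTheory
open Literature.MathematicalPhysics.QuantumLattice

namespace Summit.QuantumFields.YangMills.Theorems.WeakCouplingRates

section General

variable {d N : ℕ} {G : Type*} [Group G] [TopologicalSpace G] [IsTopologicalGroup G] [CompactSpace G]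
  [MeasurableSpace G] [BorelSpace G] [SecondCountableTopology G] (ρ : G →* Matrix (Fin N) (Fin N) ℂ)

/-- **Kernel means of gauge-invariant observables are gauge invariant in the boundary datum**:
`∫ F dγ_Λ(·|η^g) = ∫ F dγ_Λ(·|η)` for measurable gauge-invariant `F` (push the kernel forward under the gauge transformation,
`ymSpecification_map_gaugeTransformZd_holds`, and use `F ∘ g = F`). [cite: SeilerLNP1982, Ch. 2 (lattice gauge theories: locality and gauge covariance of the Wilson specification)] -/
theorem integral_ymSpecification_gaugeTransformZd (hρ : Continuous ρ) (β : ℝ) (Λ : Finset (QuantumLattice.ZdEdge d))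
    {F : LGConfig d G → ℝ} (hFm : Measurable F) (hFinv : IsZdGaugeInvariant F)
    (g : Literature.Probability.LatticeModels.Site d → G) (η : LGConfig d G) :
    ∫ U, F U ∂(ymSpecification ρ β Λ (gaugeTransformZd g η)) = ∫ U, F U ∂(ymSpecification ρ β Λ η) := by
  rw [← ymSpecification_map_gaugeTransformZd_holds ρ hρ β Λ η g,
    integral_map (measurable_gaugeTransformZd g).aemeasurable hFm.aestronglyMeasurable]
  simp only [hFinv g]

omit [TopologicalSpace G] [IsTopologicalGroup G] [CompactSpace G] [MeasurableSpace G] [BorelSpace G]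
  [SecondCountableTopology G] in
/-- The plaquette cost `plaqCostAt ρ x i j = N − Re tr ρ(U_p)` is gauge invariant. [folklore] -/
theorem isZdGaugeInvariant_plaqCostAt (x : Literature.Probability.LatticeModels.Site d) (i j : Fin d) :
    IsZdGaugeInvariant (plaqCostAt (G := G) ρ x i j) := fun g U => by
  simp only [plaqCostAt, isZdGaugeInvariant_plaquetteObs ρ x i j g U]

omit [TopologicalSpace G] [IsTopologicalGroup G] [CompactSpace G] [MeasurableSpace G] [BorelSpace G]
  [SecondCountableTopology G] in
/-- Products of plaquette costs are gauge invariant. [folklore] -/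
theorem isZdGaugeInvariant_plaqCostAt_mul (x y : Literature.Probability.LatticeModels.Site d) (i j k l : Fin d) :
    IsZdGaugeInvariant (fun U : LGConfig d G => plaqCostAt ρ x i j U * plaqCostAt ρ y k l U) := fun g U => by
  simp only [isZdGaugeInvariant_plaqCostAt ρ x i j g U, isZdGaugeInvariant_plaqCostAt ρ y k l g U]

end General

/-! ### The `SU(2)` box kernel of the line -/

/-- Kernel mean of one plaquette cost: the same at `ω` and at any gauge transform `ω^g` (`SU(2)`, any `Λ`, `β`). [folklore] -/
theorem integral_plaqCostAt_ymSpecification_gaugeTransformZd (β : ℝ) (Λ : Finset (QuantumLattice.ZdEdge 4))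
    (x : Literature.Probability.LatticeModels.Site 4) (i j : Fin 4) (g : Literature.Probability.LatticeModels.Site 4 →
      Matrix.specialUnitaryGroup (Fin 2) ℂ) (ω : LGConfig 4 (Matrix.specialUnitaryGroup (Fin 2) ℂ)) :
    ∫ U, plaqCostAt (fundamentalRep (Fin 2)) x i j U
        ∂(ymSpecification (d := 4) (fundamentalRep (Fin 2)) β Λ (gaugeTransformZd g ω)) =
      ∫ U, plaqCostAt (fundamentalRep (Fin 2)) x i j U ∂(ymSpecification (d := 4) (fundamentalRep (Fin 2)) β Λ ω) := by
  exact integral_ymSpecification_gaugeTransformZd (fundamentalRep (Fin 2)) (continuous_fundamentalRep (Fin 2)) β Λ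
    (measurable_plaqCostAt x i j) (isZdGaugeInvariant_plaqCostAt _ x i j) g ω

/-- Kernel mean of a product of two plaquette costs: the same at `ω` and at any gauge transform `ω^g`. [folklore] -/
theorem integral_plaqCostAt_mul_ymSpecification_gaugeTransformZd (β : ℝ) (Λ : Finset (QuantumLattice.ZdEdge 4))
    (x y : Literature.Probability.LatticeModels.Site 4) (i j k l : Fin 4) (g : Literature.Probability.LatticeModels.Site 4 →
      Matrix.specialUnitaryGroup (Fin 2) ℂ) (ω : LGConfig 4 (Matrix.specialUnitaryGroup (Fin 2) ℂ)) :
    ∫ U, plaqCostAt (fundamentalRep (Fin 2)) x i j U * plaqCostAt (fundamentalRep (Fin 2)) y k l U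
        ∂(ymSpecification (d := 4) (fundamentalRep (Fin 2)) β Λ (gaugeTransformZd g ω)) =
      ∫ U, plaqCostAt (fundamentalRep (Fin 2)) x i j U * plaqCostAt (fundamentalRep (Fin 2)) y k l U
        ∂(ymSpecification (d := 4) (fundamentalRep (Fin 2)) β Λ ω) := by
  exact integral_ymSpecification_gaugeTransformZd (fundamentalRep (Fin 2)) (continuous_fundamentalRep (Fin 2)) β Λ
    ((measurable_plaqCostAt x i j).mul (measurable_plaqCostAt y k l)) (isZdGaugeInvariant_plaqCostAt_mul _ x y i j k l) g ω

end Summit.QuantumFields.YangMills.Theorems.WeakCouplingRates
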